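import Literature.NumberTheory.EllipticCurves.TateParameterNotPthPowerOfJProofs
import Literature.NumberTheory.EllipticCurves.PAdicHeightsTateValuationProofs
import Literature.NumberTheory.EllipticCurves.LocalTorsionGoodReductionProofs
import HarnessLib

/-!
# The `p`-power torsion of `E(ℚ_p)` at a multiplicative prime `p` (odd): `#E(ℚ_p)[p^k] ≤ p^k`, and
# `E(ℚ_p)[p^k] = E(ℚ_p)[p^{k-1}]` (so `#E(ℚ_p)[p^k] ≤ p^{k-1}`, `∣ p^{k-1}`) when `p^k ∤ ord_p(q_E)`

`Proofs` file (THEOREMS ONLY: no definition, no named fact, no instance; D-0026 net debt 0) in topic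
`NumberTheory/EllipticCurves`; the level-`p^k` sequel of `TateParameterPrimeTorsion` (level `p`) and of
`TateParameterNotPthPowerOfJProofs` (the valuation branch at level `p`). Sources: Silverman, *Advanced
Topics*, Thm. V.3.1 (d), V.5.3 (Tate's uniformisation `E(ℚ_p) ≅ ℚ_p^×/q_E^ℤ`, DISCHARGED in the tree:
`TateCurve.tateUniformization_points_holds`), IV.9 Rem. 9.6 / VI.4 Thm. 4.2 (`ord_p q_E = ord_p Δ_min`,
the tree's `TateParameterData.valuation_q_eq_padicValInt_holds`); Serre, *A Course in Arithmetic*,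
II §3.2 Thm. 2 (`μ_{p^∞}(ℚ_p) = 1` for `p ≠ 2`); C.-H. Kim, Amer. J. Math. 148 (2026), Prop. 3.1–3.2
(the local torsion `E(ℚ_p)[p^∞]`, `t = ord_p #E(ℚ_p)[p^∞]`, in the structure theorem Thm. 1.9 (6)).

THE POINT (cell `bsd-print-x11a`, lit DOSSIER §38.8, TURNKEY T38′). In `G = ℚ_p^×/q^ℤ` (`p` odd) a
class `[u]` is killed by `p^k` iff `u^{p^k} = q^m` (`m ∈ ℤ`); `[u] ↦ m mod p^k` is INJECTIVE on `G[p^k]`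
(`μ_{p^∞}(ℚ_p) = 1`), so `#G[p^k] ≤ p^k`. If `p^k ∤ ord_p q` then `p ∣ m` (else
`p^k·ord_p u = m·ord_p q` forces `p^k ∣ ord_p q`), and `(u^{p^{k−1}} q^{−m/p})^p = 1` gives
`u^{p^{k−1}} = q^{m/p}`: **`G[p^k] = G[p^{k−1}]`**, whence `#G[p^k] ≤ p^{k−1}`. Transported to `E(ℚ_p)`:

* §1 `TatePrimeTorsion.eq_one_of_pow_primePow_eq_one`, `…exists_injective_primePowTorsion_zmod`,
  `…pow_primePow_pred_eq_one_of_not_dvd_valuation`.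
* §2 at a SPLIT multiplicative odd `p`: `finite_localPPowTorsion_of_split`,
  `natCard_localPPowTorsion_le_pow_of_split` (`#E(ℚ_p)[p^j] ≤ p^j`);
  `primePow_pred_nsmul_eq_zero_of_not_dvd_valuation_tateParameter`,
  `natCard_localPPowTorsion_le_of_not_dvd_valuation_tateParameter` (`p^k ∤ ord_p q_E` ⟹
  `p^k • P = O → p^{k−1} • P = O`, `#E(ℚ_p)[p^k] ≤ p^{k−1}`), and the same in the three record
  currencies `…_of_split_of_not_dvd_padicValInt` (`p^k ∤ ord_p Δ_min`), `…_of_split_of_not_dvd`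
  (`j(E)⁻¹ = p^{k_j}·u`, `v_p u = 0`, `p^k ∤ k_j`), `…_of_split_of_intCertificate` (`u = a/b`, `p ∤ a`,
  `p ∤ b`: `decide`-able); `natCard_localPPowTorsion_dvd_of_le` (`≤ p^j` ⟹ `∣ p^j`).
* §3 `natCard_localPPowTorsion_eq_one_of_natCard_localPTorsion_eq_one` (`E[p] = 0 ⟹ E[p^k] = 0`),
  `natCard_localPPowTorsion_eq_one_of_mult` (non-split or `p ∤ ord_p Δ_min`), and the row-complete
  DEPTH-TWO binder **`natCard_localPSqTorsion_le_of_mult_of_not_sq_dvd`**: `p ≥ 3` multiplicative,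
  `p² ∤ ord_p Δ_min` ⟹ `Nat.card {Q : E(ℚ_p) // p² • Q = 0} ≤ p` — LITERALLY the `t ≤ 1` binder of
  `Kim2022_rankZero_padicValRat_sha_of_kuriharaNumber_ne_zero_of_maninConstant_depthTwo` (good /
  additive cases: `natCard_localPSqTorsion_le_of_good` / `…_of_not_mult`). `285660u1 @ 5` (`ord₅ Δ = 5`),
  `285660u2 @ 5` (`ord₅ Δ = 15`): `25 ∤ 5, 15` ⟹ `#E(ℚ₅)[25] ≤ 5` by valuation alone.

UNCONDITIONAL (no fact binder anywhere).
## References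
* [SilvermanATAEC1994] J. H. Silverman, *Advanced Topics*, Thm. V.3.1 (d), Thm. V.5.3 (PDF pp. 395,
  407), IV.9 Rem. 9.6, VI.4 Thm. 4.2.
* [Serre1973] J.-P. Serre, *A Course in Arithmetic*, Ch. II §3.2 Thm. 2.
* [Kim2022StructureSelmer] C.-H. Kim, Amer. J. Math. 148 (2026), Prop. 3.1–3.2 (PDF p. 15), Thm. 1.9 (6).
-/
noncomputable section

open scoped Classical

namespace Literature.NumberTheory.EllipticCurves

section Padic

variable {p : ℕ} [hp : Fact p.Prime]

namespace TatePrimeTorsion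

/-- `μ_{p^k}(ℚ_p) = 1` for odd `p`: `x^{p^k} = 1 ⟹ x = 1` (induction on `k` from
`eq_one_of_pow_prime_eq_one`). [cite: Serre1973, Ch. II §3.2 Thm. 2] -/
theorem eq_one_of_pow_primePow_eq_one (hp2 : p ≠ 2) (x : ℚ_[p]) (k : ℕ) (hx : x ^ (p ^ k) = 1) :
    x = 1 := by
  induction k with
  | zero => simpa using hx
  | succ k ih =>
    apply ih
    apply eq_one_of_pow_prime_eq_one hp2
    rw [← pow_mul, ← pow_succ]
    exact hx

/-- **`(ℚ_p^×/q^ℤ)[p^j] ↪ ℤ/p^j`** (`p` odd, any `q ∈ ℚ_p^×`): `[u] ↦ m mod p^j` where `u^{p^j} = q^m`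
(two classes with the same residue differ by a `p^j`-th root of unity, `= 1`, times a power of `q`);
in particular `#(ℚ_p^×/q^ℤ)[p^j] ≤ p^j`. [cite: Serre1973, Ch. II §3.2 Thm. 2] -/
theorem exists_injective_primePowTorsion_zmod (hp2 : p ≠ 2) (q : ℚ_[p]ˣ) (j : ℕ) :
    ∃ f : {x : ℚ_[p]ˣ ⧸ Subgroup.zpowers q // x ^ (p ^ j) = 1} → ZMod (p ^ j),
      Function.Injective f := by
  have hrep : ∀ x : {x : ℚ_[p]ˣ ⧸ Subgroup.zpowers q // x ^ (p ^ j) = 1},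
      ∃ um : ℚ_[p]ˣ × ℤ, (QuotientGroup.mk um.1 : ℚ_[p]ˣ ⧸ Subgroup.zpowers q) = x.1 ∧
        um.1 ^ (p ^ j) = q ^ um.2 := by
    rintro ⟨x, hx⟩
    obtain ⟨u, rfl⟩ := QuotientGroup.mk_surjective x
    have hmem : u ^ (p ^ j) ∈ Subgroup.zpowers q := by
      rw [← QuotientGroup.eq_one_iff, QuotientGroup.mk_pow]; exact hx
    obtain ⟨m, hm⟩ := Subgroup.mem_zpowers_iff.mp hmem
    exact ⟨(u, m), rfl, hm.symm⟩
  choose um hmk hpow using hrep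
  refine ⟨fun x ↦ ((um x).2 : ZMod (p ^ j)), fun x y hxy ↦ ?_⟩
  have hxy' : ((um x).2 : ZMod (p ^ j)) = ((um y).2 : ZMod (p ^ j)) := hxy
  obtain ⟨a, ha⟩ := (ZMod.intCast_eq_intCast_iff_dvd_sub _ _ _).mp hxy'
  set w : ℚ_[p]ˣ := (um y).1 * ((um x).1)⁻¹ * q ^ (-a) with hw
  have hN : ((um y).1) ^ ((p ^ j : ℕ) : ℤ) = q ^ (um y).2 := by rw [zpow_natCast, hpow]
  have hM : ((um x).1) ^ ((p ^ j : ℕ) : ℤ) = q ^ (um x).2 := by rw [zpow_natCast, hpow]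
  have hwpow : w ^ (p ^ j) = 1 := by
    rw [← zpow_natCast w (p ^ j), hw, mul_zpow, mul_zpow, inv_zpow, hN, hM, ← zpow_mul, ← zpow_neg,
      ← zpow_add, ← zpow_add,
      show (um y).2 + -(um x).2 + -a * ((p ^ j : ℕ) : ℤ) = 0 by linear_combination ha, zpow_zero]
  have hw1 : w = 1 := by
    apply Units.val_eq_one.mp
    apply eq_one_of_pow_primePow_eq_one hp2 _ j
    rw [← Units.val_pow_eq_pow_val, hwpow, Units.val_one]
  have hquot : ((um x).1)⁻¹ * (um y).1 ∈ Subgroup.zpowers q := by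
    rw [hw, zpow_neg, mul_inv_eq_one] at hw1
    rw [mul_comm]
    exact Subgroup.mem_zpowers_iff.mpr ⟨a, hw1.symm⟩
  apply Subtype.ext
  rw [← hmk x, ← hmk y]
  exact QuotientGroup.eq.mpr hquot

/-- **`p^k ∤ ord_p q ⟹ (ℚ_p^×/q^ℤ)[p^k] = (ℚ_p^×/q^ℤ)[p^{k−1}]`** (`p` odd): `u^{p^k} = q^m` forces
`p ∣ m` (else `p^k·ord_p u = m·ord_p q`, `(p^k, m) = 1` give `p^k ∣ ord_p q`), and for `m = p m'`
the element `u^{p^{k−1}} q^{−m'}` is a `p`-th root of unity, hence `1`. [cite: Serre1973, Ch. II §3.2 Thm. 2] -/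
theorem pow_primePow_pred_eq_one_of_not_dvd_valuation (hp2 : p ≠ 2) {q : ℚ_[p]ˣ} {k : ℕ}
    (hv : ¬ (p : ℤ) ^ k ∣ Padic.valuation (q : ℚ_[p]))
    (x : ℚ_[p]ˣ ⧸ Subgroup.zpowers q) (hx : x ^ (p ^ k) = 1) : x ^ (p ^ (k - 1)) = 1 := by
  cases k with
  | zero => simp at hv
  | succ k =>
    rw [Nat.add_sub_cancel]
    obtain ⟨u, rfl⟩ := QuotientGroup.mk_surjective x
    have hmem : u ^ (p ^ (k + 1)) ∈ Subgroup.zpowers q := by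
      rw [← QuotientGroup.eq_one_iff, QuotientGroup.mk_pow]; exact hx
    obtain ⟨m, hm⟩ := Subgroup.mem_zpowers_iff.mp hmem
    rw [← QuotientGroup.mk_pow, QuotientGroup.eq_one_iff]
    by_cases hpm : (p : ℤ) ∣ m
    · obtain ⟨m', rfl⟩ := hpm
      have hw : (u ^ (p ^ k) * q ^ (-m')) ^ p = 1 := by
        rw [mul_pow, ← pow_mul, ← pow_succ, ← hm, ← zpow_natCast (q ^ (-m')) p, ← zpow_mul,
          ← zpow_add, show (p : ℤ) * m' + -m' * (p : ℤ) = 0 by ring, zpow_zero]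
      have hw1 : u ^ (p ^ k) * q ^ (-m') = 1 := by
        apply Units.val_eq_one.mp
        apply eq_one_of_pow_prime_eq_one hp2
        rw [← Units.val_pow_eq_pow_val, hw, Units.val_one]
      rw [zpow_neg, mul_inv_eq_one] at hw1
      exact Subgroup.mem_zpowers_iff.mpr ⟨m', hw1.symm⟩
    · exfalso
      apply hv
      have hu0 : (u : ℚ_[p]) ≠ 0 := u.ne_zero
      have hq0 : (q : ℚ_[p]) ≠ 0 := q.ne_zero
      have hnorm : ‖(u : ℚ_[p])‖ ^ ((p ^ (k + 1) : ℕ) : ℤ) = ‖(q : ℚ_[p])‖ ^ m := by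
        rw [← norm_zpow, ← norm_zpow, ← Units.val_zpow_eq_zpow_val, ← Units.val_zpow_eq_zpow_val,
          zpow_natCast, ← hm]
      rw [Padic.norm_eq_zpow_neg_valuation hu0, Padic.norm_eq_zpow_neg_valuation hq0, ← zpow_mul,
        ← zpow_mul] at hnorm
      have hp0 : (0 : ℝ) < p := by exact_mod_cast hp.out.pos
      have hp1 : (p : ℝ) ≠ 1 := by exact_mod_cast hp.out.one_lt.ne'
      have hexp : -(u : ℚ_[p]).valuation * ((p ^ (k + 1) : ℕ) : ℤ) =
          -(q : ℚ_[p]).valuation * m := zpow_right_injective₀ hp0 hp1 hnorm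
      push_cast at hexp
      have hP : Prime (p : ℤ) := Nat.prime_iff_prime_int.mp hp.out
      have hcop : IsCoprime ((p : ℤ) ^ (k + 1)) m :=
        ((Prime.coprime_iff_not_dvd hP).mpr hpm).pow_left
      exact hcop.dvd_of_dvd_mul_left ⟨(u : ℚ_[p]).valuation, by linear_combination hexp⟩

end TatePrimeTorsion

end Padic

/-! ### §2 On the curve: `E(ℚ_p)[p^k]` at a split multiplicative odd `p` -/
section Curve

variable {p : ℕ} [hp : Fact p.Prime] (W : WeierstrassCurve ℚ) [W.IsElliptic]

/-- `E(ℚ_p)[p^j] ↪ (ℚ_p^×/q_E^ℤ)[p^j] ↪ ℤ/p^j` along Tate's uniformisation (private set-up).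
[cite: SilvermanATAEC1994, Thm. V.3.1 (d) and Thm. V.5.3] -/
private theorem exists_injective_localPPowTorsion_zmod (hp2 : p ≠ 2)
    (D : WeierstrassCurve.TateParameterData W p) (j : ℕ) :
    ∃ h : {Q : (W.baseChange ℚ_[p]).toAffine.Point // (p ^ j : ℕ) • Q = 0} → ZMod (p ^ j),
      Function.Injective h := by
  obtain ⟨f, hbij, hadd⟩ := TateCurve.tateUniformization_points_holds W p D
  let F : (W.baseChange ℚ_[p]).toAffine.Point →+
      Additive (ℚ_[p]ˣ ⧸ Subgroup.zpowers (Units.mk0 D.q D.q_ne_zero)) := AddMonoidHom.mk' f hadd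
  have hF : ∀ P, F P = f P := fun _ ↦ rfl
  obtain ⟨g, hg⟩ :=
    TatePrimeTorsion.exists_injective_primePowTorsion_zmod hp2 (Units.mk0 D.q D.q_ne_zero) j
  have hmem : ∀ Q : {Q : (W.baseChange ℚ_[p]).toAffine.Point // (p ^ j : ℕ) • Q = 0},
      (Additive.toMul (F Q.1)) ^ (p ^ j) = 1 := by
    intro Q
    have h0 : (p ^ j) • F Q.1 = 0 := by rw [← map_nsmul, Q.2, map_zero]
    rw [← toMul_nsmul, h0, toMul_zero]
  refine ⟨fun Q ↦ g ⟨Additive.toMul (F Q.1), hmem Q⟩, fun Q Q' hQQ' ↦ ?_⟩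
  have h1 : Additive.toMul (F Q.1) = Additive.toMul (F Q'.1) := congrArg Subtype.val (hg hQQ')
  have h2 : F Q.1 = F Q'.1 := Additive.toMul.injective h1
  exact Subtype.ext (hbij.1 ((hF Q.1).symm.trans (h2.trans (hF Q'.1))))

/-- **`E(ℚ_p)[p^j]` is finite** at a split multiplicative odd `p`. [cite: SilvermanATAEC1994, Thm. V.3.1 (d), V.5.3] -/
theorem finite_localPPowTorsion_of_split (hp2 : p ≠ 2)
    (hsplit : W.HasSplitMultiplicativeReductionAtPrime p) (j : ℕ) :
    Finite {Q : (W.baseChange ℚ_[p]).toAffine.Point // (p ^ j : ℕ) • Q = 0} := by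
  obtain ⟨D⟩ := (WeierstrassCurve.nonempty_tateParameterData_iff_holds (W := W) (p := p)).mpr hsplit
  obtain ⟨h, hh⟩ := exists_injective_localPPowTorsion_zmod W hp2 D j
  haveI : NeZero (p ^ j) := ⟨pow_ne_zero _ hp.out.ne_zero⟩
  exact Finite.of_injective h hh

/-- **`#E(ℚ_p)[p^j] ≤ p^j`** at a split multiplicative odd `p` (`E(ℚ_p) ≅ ℚ_p^×/q_E^ℤ`,
`(ℚ_p^×/q^ℤ)[p^j] ↪ ℤ/p^j`). [cite: SilvermanATAEC1994, Thm. V.3.1 (d), V.5.3] [cite: Serre1973, Ch. II §3.2 Thm. 2] -/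
theorem natCard_localPPowTorsion_le_pow_of_split (hp2 : p ≠ 2)
    (hsplit : W.HasSplitMultiplicativeReductionAtPrime p) (j : ℕ) :
    Nat.card {Q : (W.baseChange ℚ_[p]).toAffine.Point // (p ^ j : ℕ) • Q = 0} ≤ p ^ j := by
  obtain ⟨D⟩ := (WeierstrassCurve.nonempty_tateParameterData_iff_holds (W := W) (p := p)).mpr hsplit
  obtain ⟨h, hh⟩ := exists_injective_localPPowTorsion_zmod W hp2 D j
  haveI : NeZero (p ^ j) := ⟨pow_ne_zero _ hp.out.ne_zero⟩
  exact (Nat.card_le_card_of_injective h hh).trans (Nat.card_zmod (p ^ j)).le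

/-- **`p^k ∤ ord_p q_E ⟹ E(ℚ_p)[p^k] = E(ℚ_p)[p^{k−1}]`** (Tate parameter datum `D` at the odd `p`):
every `P ∈ E(ℚ_p)` with `p^k P = O` has `p^{k−1} P = O`. [cite: SilvermanATAEC1994, Thm. V.3.1 (d), V.5.3] -/
theorem primePow_pred_nsmul_eq_zero_of_not_dvd_valuation_tateParameter (hp2 : p ≠ 2)
    (D : WeierstrassCurve.TateParameterData W p) {k : ℕ}
    (hk : ¬ (p : ℤ) ^ k ∣ D.q.valuation)
    (P : (W.baseChange ℚ_[p]).toAffine.Point) (hP : (p ^ k : ℕ) • P = 0) :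
    (p ^ (k - 1) : ℕ) • P = 0 := by
  obtain ⟨f, hbij, hadd⟩ := TateCurve.tateUniformization_points_holds W p D
  let F : (W.baseChange ℚ_[p]).toAffine.Point →+
      Additive (ℚ_[p]ˣ ⧸ Subgroup.zpowers (Units.mk0 D.q D.q_ne_zero)) := AddMonoidHom.mk' f hadd
  have hF : ∀ P, F P = f P := fun _ ↦ rfl
  have hv : ¬ (p : ℤ) ^ k ∣ Padic.valuation ((Units.mk0 D.q D.q_ne_zero : ℚ_[p]ˣ) : ℚ_[p]) := by
    rwa [Units.val_mk0]
  have h1 : (p ^ k) • F P = 0 := by rw [← map_nsmul, hP, map_zero]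
  have h2 : (Additive.toMul (F P)) ^ (p ^ k) = 1 := by rw [← toMul_nsmul, h1, toMul_zero]
  have h3 := TatePrimeTorsion.pow_primePow_pred_eq_one_of_not_dvd_valuation hp2 hv _ h2
  have h4 : (p ^ (k - 1)) • F P = 0 := by
    apply Additive.toMul.injective
    rw [toMul_nsmul, h3, toMul_zero]
  apply hbij.1
  rw [← hF, ← hF, map_nsmul, h4, map_zero]

/-- **`p^k ∤ ord_p q_E ⟹ #E(ℚ_p)[p^k] ≤ p^{k−1}`** (Tate parameter datum at the odd prime `p`).
[cite: SilvermanATAEC1994, Thm. V.3.1 (d) and Thm. V.5.3] [cite: Serre1973, Ch. II §3.2 Thm. 2] -/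
theorem natCard_localPPowTorsion_le_of_not_dvd_valuation_tateParameter (hp2 : p ≠ 2)
    (D : WeierstrassCurve.TateParameterData W p) {k : ℕ}
    (hk : ¬ (p : ℤ) ^ k ∣ D.q.valuation) :
    Nat.card {Q : (W.baseChange ℚ_[p]).toAffine.Point // (p ^ k : ℕ) • Q = 0} ≤ p ^ (k - 1) := by
  have hsplit : W.HasSplitMultiplicativeReductionAtPrime p :=
    (WeierstrassCurve.nonempty_tateParameterData_iff_holds (W := W) (p := p)).mp ⟨D⟩
  haveI := finite_localPPowTorsion_of_split W hp2 hsplit (k - 1)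
  let ι : {Q : (W.baseChange ℚ_[p]).toAffine.Point // (p ^ k : ℕ) • Q = 0} →
      {Q : (W.baseChange ℚ_[p]).toAffine.Point // (p ^ (k - 1) : ℕ) • Q = 0} :=
    fun Q ↦ ⟨Q.1,
      primePow_pred_nsmul_eq_zero_of_not_dvd_valuation_tateParameter W hp2 D hk Q.1 Q.2⟩
  have hι : Function.Injective ι := fun Q Q' h ↦ by
    have h' := congrArg Subtype.val h
    exact Subtype.ext h'
  exact (Nat.card_le_card_of_injective ι hι).trans
    (natCard_localPPowTorsion_le_pow_of_split W hp2 hsplit (k - 1))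

/-- **`p^k ∤ ord_p Δ_min(E) ⟹ #E(ℚ_p)[p^k] ≤ p^{k−1}` at a SPLIT multiplicative odd `p`**
(`ord_p q_E = ord_p Δ_min`, the tree's `TateParameterData.valuation_q_eq_padicValInt_holds`) — the
currency of `natCard_localPTorsion_eq_one_of_mult`.
[cite: SilvermanATAEC1994, Thm. V.3.1 (d), Thm. V.5.3, IV.9 Rem. 9.6] [cite: Serre1973, Ch. II §3.2 Thm. 2] -/
theorem natCard_localPPowTorsion_le_of_split_of_not_dvd_padicValInt [W.IsGloballyMinimal]
    (hp2 : p ≠ 2) (hsplit : W.HasSplitMultiplicativeReductionAtPrime p) {k : ℕ}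
    (hk : ¬ p ^ k ∣ padicValInt p W.minimalDiscriminantInt) :
    Nat.card {Q : (W.baseChange ℚ_[p]).toAffine.Point // (p ^ k : ℕ) • Q = 0} ≤ p ^ (k - 1) := by
  obtain ⟨D⟩ := (WeierstrassCurve.nonempty_tateParameterData_iff_holds (W := W) (p := p)).mpr hsplit
  refine natCard_localPPowTorsion_le_of_not_dvd_valuation_tateParameter W hp2 D ?_
  rw [WeierstrassCurve.TateParameterData.valuation_q_eq_padicValInt_holds (W := W) (p := p) D]
  exact_mod_cast hk

/-- `ord_p q_E = k_j` when `j(E)⁻¹ = p^{k_j}·u` with `v_p(u) = 0` (`|1/j| = |q|`, Silverman V.3.1 (b)).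
[cite: SilvermanATAEC1994, Thm. V.3.1 (b) and Lemma V.5.1 (PDF pp. 395, 406)] -/
private theorem valuation_tateParameter_eq_of_j (D : WeierstrassCurve.TateParameterData W p)
    {u : ℚ} {kj : ℕ} (hju : W.j⁻¹ = (p : ℚ) ^ kj * u) (hu0 : u ≠ 0) (hu : padicValRat p u = 0) :
    D.q.valuation = kj := by
  have hp0 : (0 : ℝ) < p := by exact_mod_cast hp.out.pos
  have hp1 : (p : ℝ) ≠ 1 := by exact_mod_cast hp.out.one_lt.ne'
  have hnu : ‖((u : ℚ) : ℚ_[p])‖ = 1 := by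
    rw [Padic.eq_padicNorm, padicNorm.eq_zpow_of_nonzero hu0, hu, neg_zero, zpow_zero, Rat.cast_one]
  have hJ : (tateJ D.q)⁻¹ = (p : ℚ_[p]) ^ kj * (u : ℚ_[p]) := by
    rw [D.tateJ_eq, ← Rat.cast_inv, hju]; push_cast; ring
  have hqn : ‖D.q‖ = (p : ℝ) ^ (-(kj : ℤ)) := by
    have h := norm_tateJ_eq D.norm_q_lt_one
    have h' : ‖(tateJ D.q)⁻¹‖ = ‖D.q‖ := by rw [norm_inv, h, inv_inv]
    rw [← h', hJ, norm_mul, Padic.norm_p_pow, hnu, mul_one]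
  rw [Padic.norm_eq_zpow_neg_valuation D.q_ne_zero] at hqn
  have := zpow_right_injective₀ hp0 hp1 hqn
  linarith

/-- **`E(ℚ_p)[p^k] = E(ℚ_p)[p^{k−1}]` from the rational datum**: split multiplicative odd `p`,
`j(W)⁻¹ = p^{k_j}·u`, `u ≠ 0`, `v_p(u) = 0`, `p^k ∤ k_j` ⟹ `p^k P = O → p^{k−1} P = O` on `E(ℚ_p)`.
[cite: SilvermanATAEC1994, Thm. V.3.1 (b), (d) and Thm. V.5.3] [cite: Serre1973, Ch. II §3.2 Thm. 2] -/
theorem primePow_pred_nsmul_eq_zero_of_split_of_not_dvd (hp2 : p ≠ 2)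
    (hsplit : W.HasSplitMultiplicativeReductionAtPrime p)
    {u : ℚ} {kj : ℕ} (hju : W.j⁻¹ = (p : ℚ) ^ kj * u) (hu0 : u ≠ 0) (hu : padicValRat p u = 0)
    {k : ℕ} (hk : ¬ p ^ k ∣ kj)
    (P : (W.baseChange ℚ_[p]).toAffine.Point) (hP : (p ^ k : ℕ) • P = 0) :
    (p ^ (k - 1) : ℕ) • P = 0 := by
  obtain ⟨D⟩ := (WeierstrassCurve.nonempty_tateParameterData_iff_holds (W := W) (p := p)).mpr hsplit
  refine primePow_pred_nsmul_eq_zero_of_not_dvd_valuation_tateParameter W hp2 D ?_ P hP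
  rw [valuation_tateParameter_eq_of_j W D hju hu0 hu]
  exact_mod_cast hk

/-- **`#E(ℚ_p)[p^k] ≤ p^{k−1}` from the rational datum**: split multiplicative odd `p`,
`j(W)⁻¹ = p^{k_j}·u`, `u ≠ 0`, `v_p(u) = 0`, `p^k ∤ k_j`.
[cite: SilvermanATAEC1994, Thm. V.3.1 (b), (d) and Thm. V.5.3] [cite: Serre1973, Ch. II §3.2 Thm. 2] -/
theorem natCard_localPPowTorsion_le_of_split_of_not_dvd (hp2 : p ≠ 2)
    (hsplit : W.HasSplitMultiplicativeReductionAtPrime p)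
    {u : ℚ} {kj : ℕ} (hju : W.j⁻¹ = (p : ℚ) ^ kj * u) (hu0 : u ≠ 0) (hu : padicValRat p u = 0)
    {k : ℕ} (hk : ¬ p ^ k ∣ kj) :
    Nat.card {Q : (W.baseChange ℚ_[p]).toAffine.Point // (p ^ k : ℕ) • Q = 0} ≤ p ^ (k - 1) := by
  obtain ⟨D⟩ := (WeierstrassCurve.nonempty_tateParameterData_iff_holds (W := W) (p := p)).mpr hsplit
  refine natCard_localPPowTorsion_le_of_not_dvd_valuation_tateParameter W hp2 D ?_
  rw [valuation_tateParameter_eq_of_j W D hju hu0 hu]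
  exact_mod_cast hk

/-- **`#E(ℚ_p)[p^k] ≤ p^{k−1}`, integer certificate form** (what a record displays and `decide`
checks): split multiplicative odd `p`, `j(W)⁻¹ = p^{k_j}·(a/b)`, `p ∤ a`, `p ∤ b`, `p^k ∤ k_j`.
[cite: SilvermanATAEC1994, Thm. V.3.1 (b), (d) and Thm. V.5.3] [cite: Serre1973, Ch. II §3.2 Thm. 2] -/
theorem natCard_localPPowTorsion_le_of_split_of_intCertificate (hp2 : p ≠ 2)
    (hsplit : W.HasSplitMultiplicativeReductionAtPrime p)
    {a b : ℤ} {kj : ℕ} (hju : W.j⁻¹ = (p : ℚ) ^ kj * ((a : ℚ) / (b : ℚ))) (ha : ¬ (p : ℤ) ∣ a)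
    (hb : ¬ (p : ℤ) ∣ b) {k : ℕ} (hk : ¬ p ^ k ∣ kj) :
    Nat.card {Q : (W.baseChange ℚ_[p]).toAffine.Point // (p ^ k : ℕ) • Q = 0} ≤ p ^ (k - 1) := by
  have ha0 : a ≠ 0 := fun h ↦ ha (h ▸ dvd_zero _)
  have hb0 : b ≠ 0 := fun h ↦ hb (h ▸ dvd_zero _)
  have haQ : (a : ℚ) ≠ 0 := Int.cast_ne_zero.mpr ha0
  have hbQ : (b : ℚ) ≠ 0 := Int.cast_ne_zero.mpr hb0
  have hu : padicValRat p ((a : ℚ) / (b : ℚ)) = 0 := by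
    rw [padicValRat.div haQ hbQ, padicValRat.of_int, padicValRat.of_int,
      padicValInt.eq_zero_of_not_dvd ha, padicValInt.eq_zero_of_not_dvd hb]
    simp
  exact natCard_localPPowTorsion_le_of_split_of_not_dvd W hp2 hsplit hju (div_ne_zero haQ hbQ) hu hk

omit [W.IsElliptic] in
/-- From `≤ p^j` to `∣ p^j`: `{Q ∈ E(ℚ_p) | p^k Q = O}` is a finite `p`-group, so its order is a power
of `p` (any `W`, any `p`; the `∣ p^{k−1}` spelling of the `t ≤ k − 1` binder, `p^t := #E(ℚ_p)[p^∞]`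
as in Kim's §1.3.5 / Prop. 3.2). [cite: Kim2022StructureSelmer, §1.3.5 (PDF p. 6) and Prop. 3.2 (PDF p. 15)] -/
theorem natCard_localPPowTorsion_dvd_of_le (k j : ℕ)
    [Finite {Q : (W.baseChange ℚ_[p]).toAffine.Point // (p ^ k : ℕ) • Q = 0}]
    (hle : Nat.card {Q : (W.baseChange ℚ_[p]).toAffine.Point // (p ^ k : ℕ) • Q = 0} ≤ p ^ j) :
    Nat.card {Q : (W.baseChange ℚ_[p]).toAffine.Point // (p ^ k : ℕ) • Q = 0} ∣ p ^ j := by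
  obtain ⟨K, hK⟩ : ∃ K : AddSubgroup (W.baseChange ℚ_[p]).toAffine.Point,
      ∀ Q, Q ∈ K ↔ (p ^ k : ℕ) • Q = 0 :=
    ⟨(nsmulAddMonoidHom (p ^ k)).ker, fun Q ↦ by rw [AddMonoidHom.mem_ker, nsmulAddMonoidHom_apply]⟩
  have e : {Q : (W.baseChange ℚ_[p]).toAffine.Point // (p ^ k : ℕ) • Q = 0} ≃ K :=
    Equiv.subtypeEquivRight fun Q ↦ (hK Q).symm
  haveI : Finite K := Finite.of_equiv _ e
  have hP : IsPGroup p (Multiplicative K) := by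
    intro g
    refine ⟨k, Multiplicative.toAdd.injective ?_⟩
    rw [toAdd_pow, toAdd_one]
    exact Subtype.ext (by simpa using (hK _).mp (Multiplicative.toAdd g).2)
  obtain ⟨m, hm0⟩ := IsPGroup.iff_card.1 hP
  have hm : Nat.card K = p ^ m := hm0
  rw [Nat.card_congr e, hm] at hle ⊢
  exact Nat.pow_dvd_pow p ((Nat.pow_le_pow_iff_right hp.out.one_lt).mp hle)

/-! ### §3 `E(ℚ_p)[p] = 0 ⟹ E(ℚ_p)[p^k] = 0`, and the depth-two binder at a multiplicative prime -/

/-- `#E(ℚ_p)[p] = 1 ⟹ #E(ℚ_p)[p^k] = 1` (no `p`-torsion, no `p`-power torsion: `t = 0`; any `W`,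
any `p`). [cite: Kim2022StructureSelmer, §1.3.5 (PDF p. 6) and Prop. 3.2 (PDF p. 15)] -/
theorem natCard_localPPowTorsion_eq_one_of_natCard_localPTorsion_eq_one (k : ℕ)
    (h1 : Nat.card {Q : (W.baseChange ℚ_[p]).toAffine.Point // (p : ℕ) • Q = 0} = 1) :
    Nat.card {Q : (W.baseChange ℚ_[p]).toAffine.Point // (p ^ k : ℕ) • Q = 0} = 1 := by
  have h := (natCard_localPTorsion_eq_one_iff W p).mp h1
  have hk : ∀ k : ℕ, ∀ P : (W.baseChange ℚ_[p]).toAffine.Point, (p ^ k : ℕ) • P = 0 → P = 0 := by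
    intro k
    induction k with
    | zero => intro P hP; simpa using hP
    | succ k ih =>
      intro P hP
      apply ih
      apply h
      rw [natCast_zsmul, ← mul_nsmul, ← pow_succ]
      exact hP
  exact Nat.card_eq_one_iff_exists.mpr
    ⟨⟨0, nsmul_zero _⟩, fun Q ↦ Subtype.ext (hk k Q.1 Q.2)⟩

/-- **`#E(ℚ_p)[p^k] = 1` at a multiplicative `p ≥ 3` that is non-split or has `p ∤ ord_p Δ_min`**
(`natCard_localPTorsion_eq_one_of_mult`, one level up). [cite: SilvermanAEC2009, VII.3 Prop. 3.1, Thm VII.6.1 and Exercise 3.5] -/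
theorem natCard_localPPowTorsion_eq_one_of_mult [W.IsGloballyMinimal] (hp3 : 3 ≤ p)
    (hmult : W.HasMultiplicativeReductionAtPrime p)
    (h : ¬ W.HasSplitMultiplicativeReductionAtPrime p ∨
      ¬ p ∣ padicValInt p W.minimalDiscriminantInt) (k : ℕ) :
    Nat.card {Q : (W.baseChange ℚ_[p]).toAffine.Point // (p ^ k : ℕ) • Q = 0} = 1 :=
  natCard_localPPowTorsion_eq_one_of_natCard_localPTorsion_eq_one W k
    (natCard_localPTorsion_eq_one_of_mult W p hp3 hmult h)

/-- **The depth-two binder at a multiplicative prime: `p ≥ 3` multiplicative, `p² ∤ ord_p Δ_min(E)`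
⟹ `#E(ℚ_p)[p²] ≤ p`** (`t ≤ 1`) — LITERALLY the `t ≤ 1` binder of
`Kim2022_rankZero_padicValRat_sha_of_kuriharaNumber_ne_zero_of_maninConstant_depthTwo`, on the rows
its good / additive discharges (`natCard_localPSqTorsion_le_of_good`, `…_of_not_mult`) do not cover:
non-split ⟹ `E(ℚ_p)[p] = 0`; split ⟹ Tate, `25 ∤ 5` at `285660u1`, `25 ∤ 15` at `285660u2`
(`p = 5`). [cite: Kim2022StructureSelmer, Prop. 3.1–3.2 (PDF p. 15), Thm. 1.9 (6) (PDF p. 8)]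
[cite: SilvermanATAEC1994, Thm. V.3.1 (d), Thm. V.5.3, IV.9 Rem. 9.6] [cite: Serre1973, Ch. II §3.2 Thm. 2] -/
theorem natCard_localPSqTorsion_le_of_mult_of_not_sq_dvd [W.IsGloballyMinimal] (hp3 : 3 ≤ p)
    (hmult : W.HasMultiplicativeReductionAtPrime p)
    (h : ¬ p ^ 2 ∣ padicValInt p W.minimalDiscriminantInt) :
    Nat.card {Q : (W.baseChange ℚ_[p]).toAffine.Point // (p ^ 2 : ℕ) • Q = 0} ≤ p := by
  by_cases hsplit : W.HasSplitMultiplicativeReductionAtPrime p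
  · simpa using natCard_localPPowTorsion_le_of_split_of_not_dvd_padicValInt W (by omega) hsplit h
  · rw [natCard_localPPowTorsion_eq_one_of_mult W hp3 hmult (Or.inl hsplit) 2]
    exact hp.out.one_lt.le

end Curve

end Literature.NumberTheory.EllipticCurves

end
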